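import Literature.AnabelianGeometry.EtaleTheta.TemperedFrobenioidToyAffineDilation
import HarnessLib

/-!
# [EtTh] Cor. 3.8, proof row `PreservesLinear` (F-2815): the bare universal closure over `Cor38Hyp` is FALSE —
# the ADMISSIBLE degree↔dilation swap over the FSMFF base `SingleObj Aff⁺(ℤ)`

S. Mochizuki, *The étale theta function …*, Publ. RIMS **45** (2009), Cor. 3.8 proof, PDF p. 81 ("`Ψ` preserves … `O^▷(−)`",
whose degree half is "`Ψ` preserves linear morphisms", [FrdI] Thm. 3.4 (iii)) [cite: MochizukiEtTh2009, Cor 3.8 p.81];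
S. Mochizuki, *The geometry of Frobenioids I* (2008), Thm. 3.4 (iii) p. 62 ("`Ψ` preserves Frobenius degrees" — for Frobenioids
with NON-DILATING `Φ` over bases of FSMFF-type), Thm. 5.2 (i) p. 100, Ex. 3.9 p. 72 [cite: MochizukiFrdI2008, Thm. 3.4 (iii) p.62].

abc-iut cell, block F, seat abc-iut-f-133 (gen 2).  PROOF-ONLY witness file (the sequel of `AffineIntegerBaseFSMType.lean`
p454013 and `TemperedFrobenioidToyAffineDilation.lean`).  In the model category of `AffDil.C` a morphism `φ : X → Y` is the data
`(deg_Fr d, base (n, u) ∈ Aff⁺(ℤ), Div z ∈ ℚ_{≥0}, unit (k, ξ))` with `ξ` FORCED by the relation of [FrdI] Thm. 5.2 (i) and `k ∈ ℤ`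
free (`hom_ext_k`); composition reads `(d₂d₁, (n₂n₁, u₂ + n₂u₁), z₂/n₁ + d₂z₁, (k₂ + d₂k₁, ·))`.  The assignment
  `σ : (d, (n, u), z, (k, ·)) ↦ (n, (d, k), (n/d)·z, (u, ·))`        (identity on objects)
exchanges Frobenius degree with base dilation AND base translation with unit — the `u`-law `u₂ + n₂u₁` and the `k`-law
`k₂ + d₂k₁` are exchanged exactly, the divisor law by abc-iut-f-142's cocycle `DilSwap.sdiv_comp` — so `σ` is a FUNCTOR
(`swap`), an involution (`swap_map_swap_map`), hence a self-EQUIVALENCE `swapEquiv : C.category ≌ C.category`; the base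
`SingleObj Aff⁺(ℤ)` IS of FSMFF-type (`IntAffine.isOfFSMFFType_D`) and "non-dilating" is vocabulary, so
`hyp : Cor38Hyp AffDil.C AffDil.C` carries `swapEquiv`.  It sends the LINEAR arrow `λ₂ = (1, (2,0), 0, (0,·))` to an arrow of
Frobenius degree `2`: **`not_preservesLinear_hyp`**, **`Cor38Hyp.not_forall_preservesLinear`** (FACT-LIST F-2815: the universal
closure, universe `0`, is FALSE; instance forms of record — `preservesLinear_of_thm34iii`, abc-iut-f-001's
`preservesLinear_treeCatVocab` — untouched).  Pre-steps (`d = 1 ∧ n = 1`) are `σ`-stable: this witness says nothing against F-2809.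
HONEST FRAMING: refuted-closure ≠ refuted-paper ([FrdI] Thm. 3.4 (iii) assumes `Φ` non-dilating, violated here by design through the
free vocabulary clause); nothing here bears on [IUTchIII] Cor. 3.12; no side taken; typed ≠ proved.
-/

noncomputable section

namespace Literature.AnabelianGeometry.EtaleTheta

open CategoryTheory Opposite Literature.AlgebraicGeometry.Frobenioids Literature.AlgebraicGeometry.Frobenioids.IntAffine

namespace AffDil

/-! ## §1 Bookkeeping in the model category of `AffDil.C` -/

/-- An element of `Φ(A) = ℚ_{≥0}` (all of `Φ^{ℝ-log}(A)`) with given value. [cite: MochizukiEtTh2009, Def 3.6 p.77] -/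
def φOf (A : (IntAffine.D)ᵒᵖ) (x : DilSwap.M) : (C.divisorMonoid.obj A : Type) :=
  (⟨x, Submonoid.mem_top x⟩ : ↥(⊤ : Submonoid DilSwap.M))

/-- The value in `ℚ_{≥0}` of an element of `Φ(A)`. [cite: MochizukiEtTh2009, Def 3.6 p.77] -/
def dval {A : (IntAffine.D)ᵒᵖ} (z : (C.divisorMonoid.obj A : Type)) : DilSwap.M := z.1

/-- `dval ∘ φOf = id`. [cite: MochizukiEtTh2009, Def 3.6 p.77] -/
@[simp] theorem dval_φOf (A : (IntAffine.D)ᵒᵖ) (x : DilSwap.M) : dval (φOf A x) = x := rfl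

/-- `φOf ∘ dval = id`. [cite: MochizukiEtTh2009, Def 3.6 p.77] -/
@[simp] theorem φOf_dval (A : (IntAffine.D)ᵒᵖ) (z : (C.divisorMonoid.obj A : Type)) : φOf A (dval z) = z :=
  Subtype.ext rfl

/-- `dval` is injective. [cite: MochizukiEtTh2009, Def 3.6 p.77] -/
theorem dval_injective (A : (IntAffine.D)ᵒᵖ) : Function.Injective (dval (A := A)) := fun _ _ h => Subtype.ext h

/-- `dval` is multiplicative. [cite: MochizukiEtTh2009, Def 3.6 p.77] -/
theorem dval_mul {A : (IntAffine.D)ᵒᵖ} (z w : (C.divisorMonoid.obj A : Type)) : dval (z * w) = dval z * dval w := rfl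

/-- `dval` and powers. [cite: MochizukiEtTh2009, Def 3.6 p.77] -/
theorem dval_pow {A : (IntAffine.D)ᵒᵖ} (z : (C.divisorMonoid.obj A : Type)) (m : ℕ) : dval (z ^ m) = dval z ^ m := rfl

/-- The pull-back of `Φ` along the base arrow `(n, u)` is the contraction `z ↦ z/n` (values). [cite: MochizukiEtTh2009, Def 3.6 p.77] -/
theorem dval_map {A B : IntAffine.D} (f : A ⟶ B) (z : (C.divisorMonoid.obj (op B) : Type)) :
    dval ((C.divisorMonoid.map f.op).hom z) = sc f (dval z) := rfl

/-- The UNIT coordinate `k ∈ ℤ` of (the rational function of) a morphism. [cite: MochizukiFrdI2008, Thm. 5.2(i) p.100] -/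
def kOf {X Y : C.category} (φ : X ⟶ Y) : Multiplicative ℤ := (ModelFrobenioid.unit φ).1.1.1

/-- `Div_B(u) = ξ` for `u = ((k, η), ξ) ∈ B`. [cite: MochizukiEtTh2009, Def 3.6 p.77] -/
theorem divB_apply (A : (IntAffine.D)ᵒᵖ) (u : (C.ratFnFunctor.obj A : Type)) :
    divB C.divisorMonoid C.ratFnFunctor C.divBNatTrans A u = u.1.2 := rfl

/-- The `η`-coordinate of a rational function is the image of its divisor class. [cite: MochizukiEtTh2009, Def 3.6 p.77] -/
theorem ratFn_fst_snd_eq (A : (IntAffine.D)ᵒᵖ) (u : (C.ratFnFunctor.obj A : Type)) : u.1.1.2 = C.ΦgpToRlog A u.1.2 := u.2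

/-- **Extensionality with the unit coordinate**: two morphisms with the same `(deg_Fr, Base, Div)` and the same `k` are equal
(the rest of the rational function is forced). [cite: MochizukiFrdI2008, Thm. 5.2(i) p.100] -/
theorem hom_ext_k {X Y : C.category} {φ ψ : X ⟶ Y} (hd : ModelFrobenioid.degFr φ = ModelFrobenioid.degFr ψ)
    (hb : ModelFrobenioid.baseMap φ = ModelFrobenioid.baseMap ψ) (hz : ModelFrobenioid.div φ = ModelFrobenioid.div ψ)
    (hk : kOf φ = kOf ψ) : φ = ψ := by
  refine ModelFrobenioid.hom_ext hd hb hz (Subtype.ext ?_)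
  -- the divisor class of `u_φ` is forced by the relation of [FrdI] Thm. 5.2 (i)
  have hforced : ∀ χ : X ⟶ Y, (ModelFrobenioid.unit χ).1.2 =
      (pullGp C.divisorMonoid (ModelFrobenioid.baseMap χ) Y.cls)⁻¹ *
        (X.cls ^ ((ModelFrobenioid.degFr χ : ℕ)) * Algebra.GrothendieckGroup.of (ModelFrobenioid.div χ)) := by
    intro χ
    have h := ModelFrobenioid.rel χ
    rw [divB_apply] at h
    rw [h, inv_mul_cancel_left]
  have h2 : (ModelFrobenioid.unit φ).1.2 = (ModelFrobenioid.unit ψ).1.2 := by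
    rw [hforced φ, hforced ψ, hd, hb, hz]
  refine Prod.ext (Prod.ext hk ?_) h2
  rw [ratFn_fst_snd_eq, ratFn_fst_snd_eq, h2]

/-- The rational function with unit coordinate `k` FORCED on the data `(m, f, x)` between `X` and `Y`.
[cite: MochizukiFrdI2008, Thm. 5.2(i) p.100] -/
def unitOf (X Y : C.category) (m : ℕ+) (f : X.base ⟶ Y.base) (x : (C.divisorMonoid.obj (op X.base) : Type))
    (k : Multiplicative ℤ) : (C.ratFnFunctor.obj (op X.base) : Type) :=
  (⟨((k, C.ΦgpToRlog (op X.base)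
      ((pullGp C.divisorMonoid f Y.cls)⁻¹ * (X.cls ^ ((m : ℕ)) * Algebra.GrothendieckGroup.of x))),
    (pullGp C.divisorMonoid f Y.cls)⁻¹ * (X.cls ^ ((m : ℕ)) * Algebra.GrothendieckGroup.of x)), rfl⟩ :
    ↥(C.ratFn (op X.base)))

/-- The morphism `X → Y` with prescribed `(deg_Fr, Base, Div, k)` (it exists for ALL data). [cite: MochizukiFrdI2008, Thm. 5.2(i) p.100] -/
def homOf (X Y : C.category) (m : ℕ+) (f : X.base ⟶ Y.base) (x : (C.divisorMonoid.obj (op X.base) : Type))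
    (k : Multiplicative ℤ) : X ⟶ Y where
  degFr := m
  base := f
  div := x
  unit := unitOf X Y m f x k
  rel := by
    rw [divB_apply]
    exact (mul_inv_cancel_left _ _).symm

/-- Components of `homOf`. [cite: MochizukiFrdI2008, Thm. 5.2(i) p.100] -/
@[simp] theorem kOf_homOf (X Y : C.category) (m : ℕ+) (f : X.base ⟶ Y.base)
    (x : (C.divisorMonoid.obj (op X.base) : Type)) (k : Multiplicative ℤ) : kOf (homOf X Y m f x k) = k := rfl

/-- `k` of an identity is `0`. [cite: MochizukiFrdI2008, Thm. 5.2(i) p.100] -/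
theorem kOf_id (X : C.category) : kOf (𝟙 X) = 1 := rfl

/-- `k` of a composite: `k₂ + d₂·k₁` (the base acts trivially on the unit coordinate). [cite: MochizukiFrdI2008, Thm. 5.2(i) p.100] -/
theorem kOf_comp {X Y Z : C.category} (φ : X ⟶ Y) (ψ : Y ⟶ Z) :
    kOf (φ ≫ ψ) = kOf ψ * kOf φ ^ ((ModelFrobenioid.degFr ψ : ℕ)) := rfl

/-! ## §2 The swap functor (identity on objects) and its involutivity -/

/-- **The swap on arrows**: `(d, (n,u), z, (k,·)) ↦ (n, (d,k), (n/d)·z, (u,·))`, between the SAME objects (the remaining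
coordinate of the rational function being forced). [cite: MochizukiFrdI2008, Thm. 5.2(i) p.100] -/
def swapHom {X Y : C.category} (φ : X ⟶ Y) : X ⟶ Y :=
  homOf X Y (expo (ModelFrobenioid.baseMap φ))
    (IntAffine.mk (ModelFrobenioid.degFr φ) (Multiplicative.toAdd (kOf φ)))
    (φOf _ (DilSwap.sdiv (ModelFrobenioid.degFr φ) (expo (ModelFrobenioid.baseMap φ)) (dval (ModelFrobenioid.div φ))))
    (Multiplicative.ofAdd (trans (ModelFrobenioid.baseMap φ)))

/-- **The swap is a functor** `C → C`, the identity on objects. [cite: MochizukiFrdI2008, Thm. 5.2(i) p.100] -/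
def swap : C.category ⥤ C.category where
  obj X := X
  map φ := swapHom φ
  map_id X := by
    apply hom_ext_k
    · change expo (1 : IntAffine.G) = 1
      exact expo_one
    · change IntAffine.mk 1 (Multiplicative.toAdd (1 : Multiplicative ℤ)) = (1 : IntAffine.G)
      rw [toAdd_one, mk_one_zero]
    · apply dval_injective
      change DilSwap.sdiv 1 (expo (1 : IntAffine.G)) (1 : DilSwap.M) = 1
      rw [expo_one, DilSwap.sdiv_one_one]
    · change Multiplicative.ofAdd (trans (1 : IntAffine.G)) = 1
      rw [trans_one, ofAdd_zero]
  map_comp {X Y Z} φ ψ := by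
    apply hom_ext_k
    · change expo (ModelFrobenioid.baseMap φ ≫ ModelFrobenioid.baseMap ψ) =
        expo (ModelFrobenioid.baseMap ψ) * expo (ModelFrobenioid.baseMap φ)
      rw [SingleObj.comp_as_mul, expo_mul]
    · change IntAffine.mk (ModelFrobenioid.degFr ψ * ModelFrobenioid.degFr φ) (Multiplicative.toAdd (kOf (φ ≫ ψ))) =
        IntAffine.mk (ModelFrobenioid.degFr ψ) (Multiplicative.toAdd (kOf ψ)) *
          IntAffine.mk (ModelFrobenioid.degFr φ) (Multiplicative.toAdd (kOf φ))
      rw [mk_mul_mk, kOf_comp, toAdd_mul, toAdd_pow, nsmul_eq_mul]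
    · apply dval_injective
      rw [ModelFrobenioid.div_comp, dval_mul, dval_pow, dval_map]
      change DilSwap.sdiv (ModelFrobenioid.degFr ψ * ModelFrobenioid.degFr φ)
          (expo (ModelFrobenioid.baseMap φ ≫ ModelFrobenioid.baseMap ψ)) (dval (ModelFrobenioid.div (φ ≫ ψ))) =
        sc (IntAffine.mk (ModelFrobenioid.degFr φ) (Multiplicative.toAdd (kOf φ)))
            (DilSwap.sdiv (ModelFrobenioid.degFr ψ) (expo (ModelFrobenioid.baseMap ψ)) (dval (ModelFrobenioid.div ψ))) *
          DilSwap.sdiv (ModelFrobenioid.degFr φ) (expo (ModelFrobenioid.baseMap φ)) (dval (ModelFrobenioid.div φ)) ^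
            ((expo (ModelFrobenioid.baseMap ψ) : ℕ))
      rw [SingleObj.comp_as_mul, expo_mul, sc, expo_mk, ModelFrobenioid.div_comp, dval_mul, dval_pow, dval_map, sc,
        DilSwap.sdiv_comp]
    · change Multiplicative.ofAdd (trans (ModelFrobenioid.baseMap φ ≫ ModelFrobenioid.baseMap ψ)) =
        Multiplicative.ofAdd (trans (ModelFrobenioid.baseMap ψ)) *
          Multiplicative.ofAdd (trans (ModelFrobenioid.baseMap φ)) ^ ((expo (ModelFrobenioid.baseMap ψ) : ℕ))
      rw [SingleObj.comp_as_mul, trans_mul, ofAdd_add, ← ofAdd_nsmul, nsmul_eq_mul]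

/-- **The swap is an involution**: `σ(σ(φ)) = φ`. [cite: MochizukiFrdI2008, Thm. 5.2(i) p.100] -/
theorem swap_map_swap_map {X Y : C.category} (φ : X ⟶ Y) : swap.map (swap.map φ) = φ := by
  apply hom_ext_k
  · change expo (IntAffine.mk (ModelFrobenioid.degFr φ) (Multiplicative.toAdd (kOf φ))) = ModelFrobenioid.degFr φ
    exact expo_mk _ _
  · change IntAffine.mk (expo (ModelFrobenioid.baseMap φ))
        (Multiplicative.toAdd (Multiplicative.ofAdd (trans (ModelFrobenioid.baseMap φ)))) = ModelFrobenioid.baseMap φ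
    rw [toAdd_ofAdd]
    exact (eq_mk _).symm
  · apply dval_injective
    change DilSwap.sdiv (expo (ModelFrobenioid.baseMap φ))
        (expo (IntAffine.mk (ModelFrobenioid.degFr φ) (Multiplicative.toAdd (kOf φ))))
        (dval (φOf _ (DilSwap.sdiv (ModelFrobenioid.degFr φ) (expo (ModelFrobenioid.baseMap φ))
          (dval (ModelFrobenioid.div φ))))) = dval (ModelFrobenioid.div φ)
    rw [expo_mk, dval_φOf, DilSwap.sdiv_sdiv]
  · change Multiplicative.ofAdd (trans (IntAffine.mk (ModelFrobenioid.degFr φ) (Multiplicative.toAdd (kOf φ)))) = kOf φ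
    rw [trans_mk, ofAdd_toAdd]

/-- **The swap as a self-equivalence** `C ⥲ C` (it is its own inverse). [cite: MochizukiEtTh2009, Cor 3.8 p.80] -/
def swapEquiv : C.category ≌ C.category :=
  CategoryTheory.Equivalence.mk swap swap
    (NatIso.ofComponents (fun X => Iso.refl X) (fun f => by
      change f ≫ 𝟙 _ = 𝟙 _ ≫ swap.map (swap.map f)
      rw [swap_map_swap_map, Category.comp_id, Category.id_comp]))
    (NatIso.ofComponents (fun X => Iso.refl X) (fun f => by
      change swap.map (swap.map f) ≫ 𝟙 _ = 𝟙 _ ≫ f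
      rw [swap_map_swap_map, Category.comp_id, Category.id_comp]))

/-- `swapEquiv.functor = swap`. [cite: MochizukiEtTh2009, Cor 3.8 p.80] -/
theorem swapEquiv_functor : swapEquiv.functor = swap := rfl

/-! ## §3 The `Cor38Hyp` record and the refutation of the universal closure of `PreservesLinear` (F-2815) -/

/-- **The record `Cor38Hyp C C` carrying the swap**: `Ψ := swapEquiv`; "`D` of FSMFF-type" is the REAL theorem
`IntAffine.isOfFSMFFType_D`; "`Φ` non-dilating" is the free vocabulary clause (`True`). [cite: MochizukiEtTh2009, Cor 3.8 p.80] -/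
def hyp : Cor38Hyp C C where
  Ψ := swapEquiv
  fsmff := ⟨isOfFSMFFType_base, isOfFSMFFType_base⟩
  nonDilating := ⟨fun _ _ => trivial, fun _ _ => trivial⟩

/-- The swap sends the linear base-dilation `λ₂` to an arrow of Frobenius degree `2`. [cite: MochizukiFrdI2008, Def. 1.2 (i) p.21] -/
theorem degFr_swap_lam₂ : C.opsData.degFr (swap.map lam₂) = 2 := by
  change expo (IntAffine.mk 2 0) = 2
  exact expo_mk _ _

/-- **`hyp` does NOT preserve linear morphisms**: `λ₂` is linear, `Ψ λ₂` has Frobenius degree `2`.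
[cite: MochizukiEtTh2009, Cor 3.8 p.81] -/
theorem not_preservesLinear_hyp : ¬ hyp.PreservesLinear := by
  intro h
  have h1 : C.opsData.degFr (swap.map lam₂) = 1 := h.1 lam₂ isLinear_lam₂
  rw [degFr_swap_lam₂] at h1
  exact absurd h1 (by decide)

/-- The base-identity LINEAR endomorphism `t₁ = (1, id, 0, (k = 1, ·)) ∈ O^▷(X₀)` (a genuine unit of `O^×`).
[cite: MochizukiFrdI2008, Def. 1.2 (ii) p.22] -/
def t₁ : X₀ ⟶ X₀ := homOf X₀ X₀ 1 (𝟙 pt) 1 (Multiplicative.ofAdd 1)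

/-- `t₁ ∈ O^▷(X₀)`. [cite: MochizukiFrdI2008, Def. 1.2 (ii) p.22] -/
theorem t₁_mem_endSubmonoid : (t₁ : End X₀) ∈ C.opsData.endSubmonoid X₀ := ⟨rfl, rfl⟩

/-- **`hyp` does NOT preserve `O^▷(−)`** either: `Ψ t₁ = (1, (1,1), 0, ·)` has base the translation `x ↦ x + 1 ≠ id`
(the [FrdI] Ex. 3.9 phenomenon, here over an FSMFF base; row F-2812 is held by abc-iut-f-023 — this is an independent second
witness, the universal statement is left to that seat). [cite: MochizukiEtTh2009, Cor 3.8 p.81] -/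
theorem not_preservesOTri_hyp : ¬ hyp.PreservesOTri := by
  intro h
  have hb : C.opsData.IsBaseIdentity (swap.map t₁) := (h.1 X₀ t₁ t₁_mem_endSubmonoid).1
  have hb' : IntAffine.mk 1 (Multiplicative.toAdd (Multiplicative.ofAdd (1 : ℤ))) = (1 : IntAffine.G) := hb
  rw [toAdd_ofAdd, ← mk_one_zero] at hb'
  exact absurd (mk_injective hb').2 (by decide)

end AffDil

/-- **FACT-LIST F-2815 — the universal closure of `Cor38Hyp.PreservesLinear` (universe `0`) is FALSE.**  Witness:
`AffDil.hyp` (the degree↔dilation swap over the FSMFF base `SingleObj Aff⁺(ℤ)`).  Instance forms of record untouched.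
[cite: MochizukiEtTh2009, Cor 3.8 p.81] -/
theorem Cor38Hyp.not_forall_preservesLinear :
    ¬ ∀ {D₀ : Type} [Category.{0} D₀] {V : FrdIMonoidStub.{0}} {T : RealifiedDivisorMonoids (D₀ := D₀) V}
        {D : Type} [Category.{0} D] {VD : FrdICatStub.{0, 0, 0} D}
        {D₀' : Type} [Category.{0} D₀'] {T' : RealifiedDivisorMonoids (D₀ := D₀') V}
        {D' : Type} [Category.{0} D'] {VD' : FrdICatStub.{0, 0, 0} D'}
        {C₁ : TemperedFrobenioid T D VD} {C₂ : TemperedFrobenioid T' D' VD'} (h : Cor38Hyp C₁ C₂),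
        h.PreservesLinear :=
  fun H => AffDil.not_preservesLinear_hyp (H AffDil.hyp)

end Literature.AnabelianGeometry.EtaleTheta

end
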